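import Mathlib
import Summits.CriticalPhenomena.SAWScalingLimit.Theorems.SAWTotalPositivityBoundaryTP2Defs
import Summits.CriticalPhenomena.SAWScalingLimit.Theorems.SAWTotalPositivityBoundaryTP2Kernel
import Summits.CriticalPhenomena.SAWScalingLimit.Theorems.SAWTotalPositivityBoundaryTP2Avoid
import Summits.CriticalPhenomena.SAWScalingLimit.Theorems.SAWTotalPositivityBoundaryTP2StarArms
import Summits.CriticalPhenomena.SAWScalingLimit.Theorems.SAWTotalPositivityBoundaryTP2Symmetry
import Summits.CriticalPhenomena.SAWScalingLimit.Theorems.SAWTotalPositivityBoundaryTP2InterlaceInherit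
import HarnessLib

/-!
# Crux `BoundaryTP2` (stmt-CriticalPhenomena-7115), line `corner-deletion-induction`: the cluster
(two-corner) expansion at an adjacent pair `p₂ ∼ p₃`

For the fugacity-`x` self-avoiding path kernel `Z = pathKernel H x` of a simple graph `H`, a vertex `c`
(the corner, `p₃`) ADJACENT to a vertex `s` (its partner, `p₂`) and a target `t ∉ {s, c}`, write
`H − c = H.deleteEdges (H.incidenceSet c)` and

* `A(s,t) = pathKernel (H − c) s t` — the paths from the partner avoiding the corner;
* `B'(c,t) = x Σ_{b ∼ c} Σ_{β : b → t in H − c, s ∉ β} x^{|β|}` — the paths from the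
  corner avoiding the partner, in first-step form;
* `E₃(t) = x Σ_{b ∼ c, b ≠ s} Σ_{β : b → t in H − c, s ∈ β} x^{|β|}` — the paths from
  the corner that reach the partner by an EXCURSION (not by the edge `c s`) and continue;
* `E₂(t) = x² Σ_{a b ∼ c, a ≠ s} Σ_{α : s → a, β : b → t in H − c} [α ⊥ β] x^{|α|+|β|}` — the paths from the partner through the corner whose first arm is a genuine
  excursion `s ⇝ c` (the path does not begin with the edge `s c`).

This file proves the two decompositions

  `Z(c,t) = B'(c,t) + x·A(s,t) + E₃(t)`        (`pathKernel_corner_eq_cluster`),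
  `V_c(s,t) = x·B'(c,t) + E₂(t)`               (`pathKernelOn_visit_eq_cluster`, `V_c` = paths through `c`),

hence `Z(s,t) = A(s,t) + x·B'(c,t) + E₂(t)` (`pathKernel_partner_eq_cluster`), and assembles them into the
**cluster expansion of the `2 × 2` minor** at a two-edge quadruple (`p₂ ∼ p₃`, targets `p₁, p₄`), additive
`ℝ≥0∞` form (`cluster_expansion`):

  `Z₂₁Z₃₄ + (A₄B'₁ + x²A₁B'₄) + ℰ⁻ = Z₃₁Z₂₄ + (A₁B'₄ + x²A₄B'₁) + ℰ⁺`,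

i.e. `det = Z₂₁Z₃₄ − Z₃₁Z₂₄ = (1 − x²)·(A₁B'₄ − A₄B'₁) + (ℰ⁺ − ℰ⁻)` where `ℰ±` collect the products
containing an excursion factor. The leading coefficient `1 − x²` is the ladder phenomenon (`Corr = −x²·Main`
exactly when no excursion exists); `A₁B'₄ − A₄B'₁ = x² Σ_{b,c'} det_{H−{p₂,p₃}}(p₁,b,c',p₄)` is a sum of
minors of the doubly deleted graph (settled by the induction hypothesis of the line), so the expansion
isolates the line's remaining analytic content in the excursion terms. Everything holds for every `x ≥ 0`
and every simple graph; all sums are unconditional sums in `ℝ≥0∞`. [folklore]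
-/

noncomputable section

namespace Summit.CriticalPhenomena.SAWScalingLimit.Theorems.BoundaryTP2

open SimpleGraph
open scoped ENNReal

variable {V : Type*}

/-- Every path from `s` visits `s`. [folklore] -/
theorem pathKernelOn_visit_start (H : SimpleGraph V) (x : ℝ) (s t : V) :
    pathKernelOn H x s t {γ | s ∈ γ.1.support} = pathKernel H x s t := by
  rw [pathKernelOn, pathKernel]
  refine tsum_congr fun γ => ?_
  exact Set.indicator_of_mem (s := {γ : H.Path s t | s ∈ γ.1.support}) (Walk.start_mem_support γ.1) _

/-- Splitting the kernel by avoiding / visiting a vertex `s`. [folklore] -/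
theorem pathKernel_eq_avoid_add_visit (H : SimpleGraph V) (x : ℝ) (a b s : V) :
    pathKernel H x a b =
      pathKernelOn H x a b {γ | s ∉ γ.1.support} + pathKernelOn H x a b {γ | s ∈ γ.1.support} := by
  have hc : ({γ : H.Path a b | s ∉ γ.1.support})ᶜ = {γ | s ∈ γ.1.support} := by
    ext γ
    simp
  rw [← hc]
  exact (pathKernelOn_add_compl x a b _).symm

open Classical in
/-- **Cluster decomposition of the kernel from the corner.** For a corner `c` adjacent to its partner `s`
and a target `t ≠ c`: `Z(c,t) = B'(c,t) + x·A(s,t) + E₃(t)` — a path from `c` avoids `s`, or steps to `s`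
at once and continues in `H − c`, or reaches `s` by an excursion. [folklore] -/
theorem pathKernel_corner_eq_cluster (H : SimpleGraph V) (x : ℝ) (hx : 0 ≤ x) (c s t : V)
    (hcs : H.Adj c s) (hct : c ≠ t) :
    pathKernel H x c t =
      (ENNReal.ofReal x * ∑' b : H.neighborSet c,
          pathKernelOn (H.deleteEdges (H.incidenceSet c)) x b t {β | s ∉ β.1.support})
        + ENNReal.ofReal x * pathKernel (H.deleteEdges (H.incidenceSet c)) x s t
        + (ENNReal.ofReal x * ∑' b : H.neighborSet c,
          if (b : V) ≠ s then pathKernelOn (H.deleteEdges (H.incidenceSet c)) x b t {β | s ∈ β.1.support}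
          else 0) := by
  classical
  -- first-step form of `Z(c,t)`, each arm kernel split by `s ∉ / s ∈`
  have h1 : pathKernel H x c t = ENNReal.ofReal x * ∑' b : H.neighborSet c,
      (pathKernelOn (H.deleteEdges (H.incidenceSet c)) x b t {β | s ∉ β.1.support}
        + pathKernelOn (H.deleteEdges (H.incidenceSet c)) x b t {β | s ∈ β.1.support}) := by
    rw [pathKernel_eq_tsum_firstArm H x hx c t hct]
    congr 1
    refine tsum_congr fun b => ?_
    rw [← pathKernel_eq_avoid_add_visit _ x (b : V) t s, pathKernel]
  -- the visiting part: isolate the term `b = s`, which is the whole kernel from `s`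
  have h2 : (∑' b : H.neighborSet c,
        pathKernelOn (H.deleteEdges (H.incidenceSet c)) x b t {β | s ∈ β.1.support}) =
      pathKernel (H.deleteEdges (H.incidenceSet c)) x s t
        + ∑' b : H.neighborSet c, if (b : V) ≠ s then
            pathKernelOn (H.deleteEdges (H.incidenceSet c)) x b t {β | s ∈ β.1.support} else 0 := by
    rw [ENNReal.tsum_eq_add_tsum_ite (⟨s, hcs⟩ : H.neighborSet c)]
    congr 1
    · exact pathKernelOn_visit_start _ x s t
    · refine tsum_congr fun b => ?_
      by_cases hb : (b : V) = s
      · have hb' : b = ⟨s, hcs⟩ := Subtype.ext hb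
        rw [if_pos hb', if_neg (not_not.2 hb)]
      · have hb' : b ≠ ⟨s, hcs⟩ := fun h => hb (congrArg Subtype.val h)
        rw [if_neg hb', if_pos hb]
  rw [h1, ENNReal.tsum_add, h2]
  ring

open Classical in
/-- **Cluster decomposition of the paths from the partner through the corner.** For a corner `c`
adjacent to its partner `s` and a target `t ≠ c`: `V_c(s,t) = x·B'(c,t) + E₂(t)` — in the two-arm form of
a path `s → ⋯ → c → ⋯ → t` (`pathKernelOn_visit_eq_tsum_arms`), the first arm is either the trivial path
(the path begins with the edge `s c`; the second arm is then any path of `H − c` to `t` avoiding `s`) or a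
genuine excursion. [folklore] -/
theorem pathKernelOn_visit_eq_cluster (H : SimpleGraph V) (x : ℝ) (hx : 0 ≤ x) (c s t : V)
    (hcs : H.Adj c s) (hct : c ≠ t) :
    pathKernelOn H x s t {γ | c ∈ γ.1.support} =
      ENNReal.ofReal x * (ENNReal.ofReal x * ∑' b : H.neighborSet c,
          pathKernelOn (H.deleteEdges (H.incidenceSet c)) x b t {β | s ∉ β.1.support}) + (ENNReal.ofReal x ^ 2 *
          ∑' (a : H.neighborSet c) (b : H.neighborSet c)
            (α : (H.deleteEdges (H.incidenceSet c)).Path s a)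
            (β : (H.deleteEdges (H.incidenceSet c)).Path b t),
            if (a : V) ≠ s ∧ List.Disjoint α.1.support β.1.support then
              ENNReal.ofReal (x ^ α.1.length) * ENNReal.ofReal (x ^ β.1.length) else 0) := by
  classical
  rw [pathKernelOn_visit_eq_tsum_arms H x hx s t c hcs.ne.symm hct.symm]
  -- the slice `a = s`: the first arm is the trivial path, the condition `α ⊥ β` becomes `s ∉ β`
  have hnil : ∀ b : H.neighborSet c,
      (∑' (α : (H.deleteEdges (H.incidenceSet c)).Path s (⟨s, hcs⟩ : H.neighborSet c))
          (β : (H.deleteEdges (H.incidenceSet c)).Path b t),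
          if List.Disjoint α.1.support β.1.support then
            ENNReal.ofReal (x ^ α.1.length) * ENNReal.ofReal (x ^ β.1.length) else 0) =
        pathKernelOn (H.deleteEdges (H.incidenceSet c)) x b t {β | s ∉ β.1.support} := by
    intro b
    rw [tsum_eq_single (SimpleGraph.Path.nil : (H.deleteEdges (H.incidenceSet c)).Path s s)
      (fun α hα => absurd (SimpleGraph.Path.loop_eq α) hα), pathKernelOn]
    refine tsum_congr fun β => ?_
    by_cases hs : s ∈ β.1.support
    · have hd : ¬ List.Disjoint
          (SimpleGraph.Path.nil : (H.deleteEdges (H.incidenceSet c)).Path s s).1.support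
          β.1.support := fun h => h (by simp) hs
      rw [if_neg hd, Set.indicator_of_notMem
        (s := {β : (H.deleteEdges (H.incidenceSet c)).Path (b : V) t | s ∉ β.1.support})
        (fun h => h hs)]
    · have hd : List.Disjoint
          (SimpleGraph.Path.nil : (H.deleteEdges (H.incidenceSet c)).Path s s).1.support
          β.1.support := by
        intro v hv hv'
        have hv0 : v = s := by simpa using hv
        exact hs (hv0 ▸ hv')
      rw [if_pos hd, Set.indicator_of_mem
        (s := {β : (H.deleteEdges (H.incidenceSet c)).Path (b : V) t | s ∉ β.1.support}) hs]
      simp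
  -- split the `a`-sum at `a = s`
  rw [ENNReal.tsum_eq_add_tsum_ite (⟨s, hcs⟩ : H.neighborSet c), mul_add]
  congr 1
  · rw [← mul_assoc, ← pow_two]
    congr 1
    exact tsum_congr hnil
  · congr 1
    refine tsum_congr fun a => ?_
    by_cases ha : (a : V) = s
    · have ha' : a = ⟨s, hcs⟩ := Subtype.ext ha
      rw [if_pos ha']
      symm
      refine ENNReal.tsum_eq_zero.2 fun b => ENNReal.tsum_eq_zero.2 fun α =>
        ENNReal.tsum_eq_zero.2 fun β => ?_
      rw [if_neg (fun h => h.1 ha)]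
    · have ha' : a ≠ ⟨s, hcs⟩ := fun h => ha (congrArg Subtype.val h)
      rw [if_neg ha']
      refine tsum_congr fun b => tsum_congr fun α => tsum_congr fun β => ?_
      by_cases hd : List.Disjoint α.1.support β.1.support
      · rw [if_pos hd, if_pos ⟨ha, hd⟩]
      · rw [if_neg hd, if_neg (fun h => hd h.2)]

open Classical in
/-- **Cluster decomposition of the kernel from the partner.** For `c ∼ s` and `t ∉ {s, c}`:
`Z(s,t) = A(s,t) + x·B'(c,t) + E₂(t)`. [folklore] -/
theorem pathKernel_partner_eq_cluster (H : SimpleGraph V) (x : ℝ) (hx : 0 ≤ x) (c s t : V)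
    (hcs : H.Adj c s) (hct : c ≠ t) :
    pathKernel H x s t =
      pathKernel (H.deleteEdges (H.incidenceSet c)) x s t
        + ENNReal.ofReal x * (ENNReal.ofReal x * ∑' b : H.neighborSet c,
          pathKernelOn (H.deleteEdges (H.incidenceSet c)) x b t {β | s ∉ β.1.support}) + (ENNReal.ofReal x ^ 2 *
          ∑' (a : H.neighborSet c) (b : H.neighborSet c)
            (α : (H.deleteEdges (H.incidenceSet c)).Path s a)
            (β : (H.deleteEdges (H.incidenceSet c)).Path b t),
            if (a : V) ≠ s ∧ List.Disjoint α.1.support β.1.support then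
              ENNReal.ofReal (x ^ α.1.length) * ENNReal.ofReal (x ^ β.1.length) else 0) := by
  rw [pathKernel_eq_avoid_add_visit H x s t c, pathKernelOn_visit_eq_cluster H x hx c s t hcs hct,
    stub_pathKernelOn_avoid H x s t c hcs.ne.symm hct.symm, add_assoc]

open Classical in
/-- **Cluster expansion of the `2 × 2` minor at a two-edge quadruple** (additive `ℝ≥0∞` form, every
`x ≥ 0`, every simple graph). For the corner `p₃` adjacent to its partner `p₂` and targets `p₁, p₄ ≠ p₃`,
with `Aⱼ = pathKernel (H − p₃) x p₂ pⱼ` and `B'ⱼ`, `E₂j`, `E₃j` the kernels `B'`, `E₂`, `E₃` of the module docstring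
with target `pⱼ` (`j = 1, 4`):

`Z₂₁Z₃₄ + (A₄B'₁ + x²·A₁B'₄) + [(A₄ + xB'₄ + E₂4)·E₃1 + E₂4·(B'₁ + xA₁)]`
`  = Z₃₁Z₂₄ + (A₁B'₄ + x²·A₄B'₁) + [(A₁ + xB'₁ + E₂1)·E₃4 + E₂1·(B'₄ + xA₄)]`,

i.e. `Z₂₁Z₃₄ − Z₃₁Z₂₄ = (1 − x²)(A₁B'₄ − A₄B'₁) + (excursion terms)`: the ladder factor `1 − x²` times a
combination of minors of `H − {p₂, p₃}`, plus terms each carrying an excursion kernel. It is `ring` after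
the decompositions `Z₂ⱼ = Aⱼ + xB'ⱼ + E₂j`, `Z₃ⱼ = B'ⱼ + xAⱼ + E₃j`. [folklore] -/
theorem cluster_expansion (H : SimpleGraph V) (x : ℝ) (hx : 0 ≤ x) (p₁ p₂ p₃ p₄ : V)
    (h₂₃ : H.Adj p₃ p₂) (h₁ : p₃ ≠ p₁) (h₄ : p₃ ≠ p₄) :
    pathKernel H x p₂ p₁ * pathKernel H x p₃ p₄
      + (pathKernel (H.deleteEdges (H.incidenceSet p₃)) x p₂ p₄ * (ENNReal.ofReal x * ∑' b : H.neighborSet p₃,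
          pathKernelOn (H.deleteEdges (H.incidenceSet p₃)) x b p₁ {β | p₂ ∉ β.1.support})
          + ENNReal.ofReal x ^ 2 *
            (pathKernel (H.deleteEdges (H.incidenceSet p₃)) x p₂ p₁ * (ENNReal.ofReal x * ∑' b : H.neighborSet p₃,
          pathKernelOn (H.deleteEdges (H.incidenceSet p₃)) x b p₄ {β | p₂ ∉ β.1.support})))
      + ((pathKernel (H.deleteEdges (H.incidenceSet p₃)) x p₂ p₄
            + ENNReal.ofReal x * (ENNReal.ofReal x * ∑' b : H.neighborSet p₃,
          pathKernelOn (H.deleteEdges (H.incidenceSet p₃)) x b p₄ {β | p₂ ∉ β.1.support}) + (ENNReal.ofReal x ^ 2 *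
          ∑' (a : H.neighborSet p₃) (b : H.neighborSet p₃)
            (α : (H.deleteEdges (H.incidenceSet p₃)).Path p₂ a)
            (β : (H.deleteEdges (H.incidenceSet p₃)).Path b p₄),
            if (a : V) ≠ p₂ ∧ List.Disjoint α.1.support β.1.support then
              ENNReal.ofReal (x ^ α.1.length) * ENNReal.ofReal (x ^ β.1.length) else 0))
            * (ENNReal.ofReal x * ∑' b : H.neighborSet p₃,
          if (b : V) ≠ p₂ then pathKernelOn (H.deleteEdges (H.incidenceSet p₃)) x b p₁ {β | p₂ ∈ β.1.support}
          else 0)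
          + (ENNReal.ofReal x ^ 2 *
          ∑' (a : H.neighborSet p₃) (b : H.neighborSet p₃)
            (α : (H.deleteEdges (H.incidenceSet p₃)).Path p₂ a)
            (β : (H.deleteEdges (H.incidenceSet p₃)).Path b p₄),
            if (a : V) ≠ p₂ ∧ List.Disjoint α.1.support β.1.support then
              ENNReal.ofReal (x ^ α.1.length) * ENNReal.ofReal (x ^ β.1.length) else 0) *
            ((ENNReal.ofReal x * ∑' b : H.neighborSet p₃,
          pathKernelOn (H.deleteEdges (H.incidenceSet p₃)) x b p₁ {β | p₂ ∉ β.1.support})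
              + ENNReal.ofReal x * pathKernel (H.deleteEdges (H.incidenceSet p₃)) x p₂ p₁)) =
    pathKernel H x p₃ p₁ * pathKernel H x p₂ p₄
      + (pathKernel (H.deleteEdges (H.incidenceSet p₃)) x p₂ p₁ * (ENNReal.ofReal x * ∑' b : H.neighborSet p₃,
          pathKernelOn (H.deleteEdges (H.incidenceSet p₃)) x b p₄ {β | p₂ ∉ β.1.support})
          + ENNReal.ofReal x ^ 2 *
            (pathKernel (H.deleteEdges (H.incidenceSet p₃)) x p₂ p₄ * (ENNReal.ofReal x * ∑' b : H.neighborSet p₃,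
          pathKernelOn (H.deleteEdges (H.incidenceSet p₃)) x b p₁ {β | p₂ ∉ β.1.support})))
      + ((pathKernel (H.deleteEdges (H.incidenceSet p₃)) x p₂ p₁
            + ENNReal.ofReal x * (ENNReal.ofReal x * ∑' b : H.neighborSet p₃,
          pathKernelOn (H.deleteEdges (H.incidenceSet p₃)) x b p₁ {β | p₂ ∉ β.1.support}) + (ENNReal.ofReal x ^ 2 *
          ∑' (a : H.neighborSet p₃) (b : H.neighborSet p₃)
            (α : (H.deleteEdges (H.incidenceSet p₃)).Path p₂ a)
            (β : (H.deleteEdges (H.incidenceSet p₃)).Path b p₁),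
            if (a : V) ≠ p₂ ∧ List.Disjoint α.1.support β.1.support then
              ENNReal.ofReal (x ^ α.1.length) * ENNReal.ofReal (x ^ β.1.length) else 0))
            * (ENNReal.ofReal x * ∑' b : H.neighborSet p₃,
          if (b : V) ≠ p₂ then pathKernelOn (H.deleteEdges (H.incidenceSet p₃)) x b p₄ {β | p₂ ∈ β.1.support}
          else 0)
          + (ENNReal.ofReal x ^ 2 *
          ∑' (a : H.neighborSet p₃) (b : H.neighborSet p₃)
            (α : (H.deleteEdges (H.incidenceSet p₃)).Path p₂ a)
            (β : (H.deleteEdges (H.incidenceSet p₃)).Path b p₁),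
            if (a : V) ≠ p₂ ∧ List.Disjoint α.1.support β.1.support then
              ENNReal.ofReal (x ^ α.1.length) * ENNReal.ofReal (x ^ β.1.length) else 0) *
            ((ENNReal.ofReal x * ∑' b : H.neighborSet p₃,
          pathKernelOn (H.deleteEdges (H.incidenceSet p₃)) x b p₄ {β | p₂ ∉ β.1.support})
              + ENNReal.ofReal x * pathKernel (H.deleteEdges (H.incidenceSet p₃)) x p₂ p₄)) := by
  rw [pathKernel_partner_eq_cluster H x hx p₃ p₂ p₁ h₂₃ h₁,
    pathKernel_partner_eq_cluster H x hx p₃ p₂ p₄ h₂₃ h₄,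
    pathKernel_corner_eq_cluster H x hx p₃ p₂ p₁ h₂₃ h₁,
    pathKernel_corner_eq_cluster H x hx p₃ p₂ p₄ h₂₃ h₄]
  ring

/-- **Interlacing is inherited by deleting the cluster.** If `(p₁, p₂, p₃, p₄)` is interlaced in `H`,
`b ∼ p₂` with `b ≠ p₃`, `c ∼ p₃` with `c ≠ p₂`, and `p₁, p₄ ∉ {p₂, p₃}`, then `(p₁, b, c, p₄)` is interlaced in
the doubly deleted graph `(H − p₃) − p₂`: extend a path `p₁ → c` by the edge `c p₃` and a path `b → p₄` by the
edge `p₂ b`; interlacing in `H` gives a common vertex, which is neither `p₂` nor `p₃`. (Twice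
`stub_interlaced_deleteVert`, conjugated by the Klein reflection.) These are the quadruples of the minors
`det_{H−{p₂,p₃}}(p₁,b,c,p₄)` summed in the leading term `A₁B'₄ − A₄B'₁` of `cluster_expansion`. [folklore] -/
theorem interlaced_deleteCluster (H : SimpleGraph V) (p₁ p₂ p₃ p₄ b c : V)
    (hI : Interlaced H p₁ p₂ p₃ p₄) (hb : H.Adj b p₂) (hb₃ : b ≠ p₃) (hc : H.Adj c p₃) (hc₂ : c ≠ p₂)
    (h₁₃ : p₃ ≠ p₁) (h₂₃ : p₃ ≠ p₂) (h₃₄ : p₃ ≠ p₄) (h₁₂ : p₂ ≠ p₁) (h₂₄ : p₂ ≠ p₄) :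
    Interlaced ((H.deleteEdges (H.incidenceSet p₃)).deleteEdges
        ((H.deleteEdges (H.incidenceSet p₃)).incidenceSet p₂)) p₁ b c p₄ := by
  -- delete the corner `p₃`: `(p₁, p₂, c, p₄)` is interlaced in `H − p₃`
  have h1 : Interlaced (H.deleteEdges (H.incidenceSet p₃)) p₁ p₂ c p₄ :=
    stub_interlaced_deleteVert H p₁ p₂ p₃ p₄ c hI hc h₁₃ h₂₃ h₃₄
  -- reflect, delete the partner `p₂` (corner of the reflected quadruple `(p₄, c, p₂, p₁)`), reflect back
  have hb' : (H.deleteEdges (H.incidenceSet p₃)).Adj b p₂ := by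
    rw [SimpleGraph.deleteEdges_adj, SimpleGraph.mk'_mem_incidenceSet_iff]
    exact ⟨hb, fun h => h.2.elim (fun h' => hb₃ h'.symm) (fun h' => h₂₃ h')⟩
  exact (stub_interlaced_deleteVert _ p₄ c p₂ p₁ b h1.reflect hb' h₂₄ hc₂.symm h₁₂).reflect

/-- **The leading term is a double sum over the cluster's neighbours.** With `G = H − p₃` and
`G° = G − p₂` (the cluster deleted), the first-arm decomposition of `A(t) = Z_G(p₂,t)` at `p₂` turns the products
`Aₜ·B'ₜ'` of `cluster_expansion` into `x² Σ_{b ∼ p₂ in G} Σ_{c ∼ p₃} Z_{G°}(b,t) · Σ_{γ : c → t' in G, p₂ ∉ γ} x^{|γ|}`;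
for `c ≠ p₂` the last factor is `Z_{G°}(c,t')` (`stub_pathKernelOn_avoid`) and for `c = p₂` it vanishes, so
`A₁B'₄ − A₄B'₁ = x² Σ_{b,c} (Z_{G°}(b,p₁)Z_{G°}(c,p₄) − Z_{G°}(b,p₄)Z_{G°}(c,p₁))`, a sum of `2 × 2` minors of the
doubly deleted graph at the quadruples `(p₁, b, c, p₄)` of `interlaced_deleteCluster`. [folklore] -/
theorem partnerAvoid_mul_cornerAvoid (H : SimpleGraph V) (x : ℝ) (hx : 0 ≤ x) (p₂ p₃ t t' : V)
    (h : p₂ ≠ t) :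
    pathKernel (H.deleteEdges (H.incidenceSet p₃)) x p₂ t
        * (ENNReal.ofReal x * ∑' c : H.neighborSet p₃,
            pathKernelOn (H.deleteEdges (H.incidenceSet p₃)) x c t' {β | p₂ ∉ β.1.support}) =
      ENNReal.ofReal x ^ 2 *
        ∑' (b : (H.deleteEdges (H.incidenceSet p₃)).neighborSet p₂) (c : H.neighborSet p₃),
          pathKernel ((H.deleteEdges (H.incidenceSet p₃)).deleteEdges
              ((H.deleteEdges (H.incidenceSet p₃)).incidenceSet p₂)) x b t
            * pathKernelOn (H.deleteEdges (H.incidenceSet p₃)) x c t' {β | p₂ ∉ β.1.support} := by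
  have hA : pathKernel (H.deleteEdges (H.incidenceSet p₃)) x p₂ t =
      ENNReal.ofReal x * ∑' b : (H.deleteEdges (H.incidenceSet p₃)).neighborSet p₂,
        pathKernel ((H.deleteEdges (H.incidenceSet p₃)).deleteEdges
          ((H.deleteEdges (H.incidenceSet p₃)).incidenceSet p₂)) x b t := by
    rw [pathKernel_eq_tsum_firstArm _ x hx p₂ t h]
    rfl
  rw [hA]
  calc ENNReal.ofReal x * (∑' b : (H.deleteEdges (H.incidenceSet p₃)).neighborSet p₂,
          pathKernel ((H.deleteEdges (H.incidenceSet p₃)).deleteEdges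
            ((H.deleteEdges (H.incidenceSet p₃)).incidenceSet p₂)) x b t)
        * (ENNReal.ofReal x * ∑' c : H.neighborSet p₃,
            pathKernelOn (H.deleteEdges (H.incidenceSet p₃)) x c t' {β | p₂ ∉ β.1.support})
      = ENNReal.ofReal x ^ 2 * ((∑' b : (H.deleteEdges (H.incidenceSet p₃)).neighborSet p₂,
          pathKernel ((H.deleteEdges (H.incidenceSet p₃)).deleteEdges
            ((H.deleteEdges (H.incidenceSet p₃)).incidenceSet p₂)) x b t)
          * ∑' c : H.neighborSet p₃,
            pathKernelOn (H.deleteEdges (H.incidenceSet p₃)) x c t' {β | p₂ ∉ β.1.support}) := by ring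
    _ = _ := by
      congr 1
      rw [← ENNReal.tsum_mul_right]
      exact tsum_congr fun b => ENNReal.tsum_mul_left.symm

end Summit.CriticalPhenomena.SAWScalingLimit.Theorems.BoundaryTP2
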